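import Mathlib
import Literature.Analysis.Calculus.NestedJets
import Literature.Analysis.Calculus.MixedPartialDerivWithin
import HarnessLib

/-!
# Nested two-variable jets with a ONE-SIDED inner variable: propagation through products and smooth
# outer functions

Analysis/Calculus support file (everything proved; theorems only, no definitions, no named facts) — the
companion of `Literature.Analysis.Calculus.NestedJets` (two-sided inner variable) for functions
`F : ℝ → ℝ → ℝ` that are smooth only on a slab `ℝ × I` (`I ⊆ ℝ` a set of unique differentiability, e.g.
the closed half-line `Set.Ici 0`), the derivatives in the second variable being taken WITHIN `I` at a
point `t₀ ∈ I`: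

the **nested one-sided `(a, b)`-coefficient at `(0, t₀)`** is
`iteratedDeriv a (fun u => iteratedDerivWithin b (F u) I t₀) 0` — first `b` derivatives within `I` in the
second variable at `t₀`, then `a` (two-sided) derivatives in the first variable at `0`.  This is the shape
of the ONE-SIDED truncated double Taylor sums of the tree
(`…Balaban1983to89.B1Sect3Statements.pertSum362R`: Bałaban's perturbative formula (3.36)/(3.62) with the
`λ′`-derivatives taken from the right at `0⁺`, the generating functions (3.35) being finite only for
`λ′ ≥ 0`).  Two functions have *equal nested one-sided `n`-jets* when these coefficients agree for all
`a + b ≤ n`.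

Main results (data `C^∞` within the slab `univ ×ˢ I`, `UniqueDiffOn ℝ I`, `t₀ ∈ I`):
* `contDiffOn_slice` / `contDiff_iteratedDerivWithin_slice` — each slice `F u` is `C^∞` within `I`, and
  the within-derivatives `u ↦ ∂^b_{s,I}F(u, t₀)` are `C^∞` functions of the free variable (also for a
  normed parameter space in place of `ℝ`: the dictionary of
  `Literature.Analysis.Calculus.MixedPartialDerivWithin`, Coleman §4.5);
* `congr_slab` — the nested one-sided coefficients depend only on the values of `F` on `ℝ × I`;
* **`NestedJetWithin.comp`**, **`NestedJetWithin.mul`** — equal nested one-sided `n`-jets are preserved by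
  composition with an outer function smooth on an open set containing the values on the slab, and by
  multiplication with a common factor smooth within the slab — Dieudonné IV (19.5.5) / (19.5.1) in the
  nested one-sided form: Faà di Bruno / Leibniz WITHIN `I` in the inner variable (Mathlib's
  `iteratedDerivWithin_comp_eq_sum_orderedFinpartition`, `iteratedDerivWithin_mul`) as identities of
  functions of the outer variable, then the two-sided one-variable jet calculus of `NestedJets`
  (`NestedJet.jet_sum`, `jet_mul`, `jet_prod`, `jet_comp`) in the outer variable;
* `contDiff_uncurry_iteratedDerivWithin_slice₂` — for `K : ℝ → ℝ → ℝ → ℝ` smooth within `(ℝ × ℝ) × I`, the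
  one-sided derivative in the last variable, `(u, s) ↦ ∂^b_{t,I}K(u, s, t₀)`, is jointly `C^∞` on `ℝ²` — so
  that the two-sided diagonal Taylor lemma `NestedJet.iteratedDeriv_diag_eq_taylorSum` applies to it.

Consumer: the one-sided version of the step (3.62) ⇒ (3.63) of Bałaban, Commun. Math. Phys. 85 (1982),
p. 624 — `…Balaban1983to89.B1Eq363JetWithin` (`…B1Eq363JetProof` is the two-sided version); filed by the
lit-balaban typer (statement-level skeleton of published theorems with citation tags; proofs where landed;
nothing here is a claim about the Yang–Mills mass gap).  v1.1: this framing sentence only (docstring;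
declarations byte-identical to v1 = p382582).

Sources: J. Dieudonné, *Treatise on Analysis* IV, §19.5 — (19.5.1) the ideal `o_m(U)` of smooth functions
vanishing to order `m`, (19.5.5) the Taylor series of a composite is the composite of the Taylor series
[lit key `book:dieudonne1969-treatise-analysis`, pp. 207–208, as read for `NestedJets`]; R. Coleman,
*Calculus on Normed Vector Spaces*, §4.5 (partial derivatives as entries of the total derivative) as read
for `MixedPartialDerivWithin`.  The theorems below are the nested one-sided forms the consumer needs;
`private` lemmas are Mathlib plumbing.

## References

* J. Dieudonné, *Treatise on Analysis*, Vol. IV, Pure and Applied Mathematics 10-IV, Academic Press 1974,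
  Ch. XIX §5, (19.5.1)–(19.5.5). [Dieudonne1974TreatiseIV]
* R. Coleman, *Calculus on Normed Vector Spaces*, Universitext, Springer 2012, §4.5. [Coleman2012]
-/

noncomputable section

open scoped ContDiff Topology
open Set

namespace Literature.Analysis.Calculus.NestedJetWithin

open Literature.Analysis.Calculus

/-! ### Exponent bookkeeping in `ℕ∞ω` -/

/-- `∞ + 1 ≤ ∞` in `WithTop ℕ∞` (definitional). [folklore] -/
private theorem infty_add_one_le : (∞ : ℕ∞ω) + 1 ≤ ∞ := le_rfl

/-- `n ≤ ∞` for a natural number `n`. [folklore] -/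
private theorem natCast_le_infty (n : ℕ) : (n : ℕ∞ω) ≤ ∞ := mod_cast le_top

/-- `∞ + n ≤ ∞`. [folklore] -/
private theorem infty_add_natCast_le (n : ℕ) : (∞ : ℕ∞ω) + n ≤ ∞ := by
  induction n with
  | zero => simp
  | succ n ih =>
    calc (∞ : ℕ∞ω) + (((n + 1 : ℕ)) : ℕ∞ω) = ((∞ : ℕ∞ω) + n) + 1 := by push_cast; rw [add_assoc]
      _ ≤ ∞ + 1 := by gcongr
      _ ≤ ∞ := infty_add_one_le

/-- All derivatives of a function smooth on an open set are smooth there. [folklore] -/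
private theorem contDiffOn_iteratedDeriv {U : Set ℝ} (hU : IsOpen U) {φ : ℝ → ℝ}
    (hφ : ContDiffOn ℝ ∞ φ U) : ∀ ℓ : ℕ, ContDiffOn ℝ ∞ (iteratedDeriv ℓ φ) U
  | 0 => by simpa using hφ
  | ℓ + 1 => by
    rw [iteratedDeriv_succ]
    exact (contDiffOn_iteratedDeriv hU hφ ℓ).deriv_of_isOpen hU infty_add_one_le

/-! ### Slices of a function smooth within a slab `univ ×ˢ I` -/

section Slice

variable {P : Type*} [NormedAddCommGroup P] [NormedSpace ℝ P]

/-- Each slice `H p = H(p, ·)` of a function `C^∞` within the slab `univ ×ˢ I` is `C^∞` within `I`.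
[cite: Coleman2012, §4.5] -/
theorem contDiffOn_slice {H : P → ℝ → ℝ} {I : Set ℝ}
    (hH : ContDiffOn ℝ ∞ (Function.uncurry H) (univ ×ˢ I)) (p : P) : ContDiffOn ℝ ∞ (H p) I :=
  hH.comp (f := fun s : ℝ => ((p, s) : P × ℝ)) (contDiff_const.prodMk contDiff_id).contDiffOn
    fun _ hs => ⟨mem_univ p, hs⟩

/-- The value slice `p ↦ H(p, t₀)` (`t₀ ∈ I`) is `C^∞`. [cite: Coleman2012, §4.5] -/
theorem contDiff_slice_val {H : P → ℝ → ℝ} {I : Set ℝ}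
    (hH : ContDiffOn ℝ ∞ (Function.uncurry H) (univ ×ˢ I)) {t₀ : ℝ} (ht₀ : t₀ ∈ I) :
    ContDiff ℝ ∞ (fun p => H p t₀) :=
  hH.comp_contDiff (contDiff_id.prodMk contDiff_const) fun p => ⟨mem_univ p, ht₀⟩

/-- **The within-derivatives in the constrained variable are smooth in the free variable**: for `H`
of class `C^∞` within `univ ×ˢ I` (`I` of unique differentiability) and `t₀ ∈ I`, the function
`p ↦ ∂^b_{s,I}H(p, t₀) = iteratedDerivWithin b (H p) I t₀` is `C^∞` on the parameter space (it is the
entry of the joint within-derivative `D^b_{univ×I}H(p, t₀)` on `b` copies of `(0, 1)`,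
`MixedPartialDerivWithin.iteratedDerivWithin_slice_snd_apply`, and `D^bH` is `C^∞` within the slab).
[cite: Coleman2012, §4.5] -/
theorem contDiff_iteratedDerivWithin_slice {H : P → ℝ → ℝ} {I : Set ℝ}
    (hH : ContDiffOn ℝ ∞ (Function.uncurry H) (univ ×ˢ I)) (hI : UniqueDiffOn ℝ I) {t₀ : ℝ}
    (ht₀ : t₀ ∈ I) (b : ℕ) : ContDiff ℝ ∞ (fun p => iteratedDerivWithin b (H p) I t₀) := by
  have hS : UniqueDiffOn ℝ (univ ×ˢ I : Set (P × ℝ)) := uniqueDiffOn_univ.prod hI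
  have h1 : (fun p => iteratedDerivWithin b (H p) I t₀)
      = fun p => (fun q : P × ℝ => iteratedFDerivWithin ℝ b (Function.uncurry H) (univ ×ˢ I) q
          (fun _ => ((0 : P), (1 : ℝ)))) (p, t₀) := by
    funext p
    exact iteratedDerivWithin_slice_snd_apply hH hI p (natCast_le_infty b) ht₀
  rw [h1]
  have hD : ContDiffOn ℝ ∞ (iteratedFDerivWithin ℝ b (Function.uncurry H) (univ ×ˢ I)) (univ ×ˢ I) :=
    fun q hq => (hH q hq).iteratedFDerivWithin_right hS (infty_add_natCast_le b) hq
  have hDw : ContDiffOn ℝ ∞ (fun q : P × ℝ => iteratedFDerivWithin ℝ b (Function.uncurry H) (univ ×ˢ I) q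
      (fun _ => ((0 : P), (1 : ℝ)))) (univ ×ˢ I) :=
    (ContinuousMultilinearMap.apply ℝ (fun _ : Fin b => P × ℝ) ℝ (fun _ => ((0 : P), (1 : ℝ)))).contDiff
      |>.comp_contDiffOn hD
  exact hDw.comp_contDiff (contDiff_id.prodMk contDiff_const) fun p => ⟨mem_univ p, ht₀⟩

/-- Pointwise form: each slice is `C^b` within `I` at `t₀` (what the within-Leibniz and Faà di Bruno
formulas ask). [cite: Coleman2012, §4.5] -/
theorem contDiffWithinAt_slice {H : P → ℝ → ℝ} {I : Set ℝ}
    (hH : ContDiffOn ℝ ∞ (Function.uncurry H) (univ ×ˢ I)) {t₀ : ℝ} (ht₀ : t₀ ∈ I) (p : P) (b : ℕ) :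
    ContDiffWithinAt ℝ (b : ℕ∞ω) (H p) I t₀ :=
  ((contDiffOn_slice hH p) t₀ ht₀).of_le (natCast_le_infty b)

end Slice

/-! ### Nested one-sided jets: dependence on the slab only, composition and products -/

section Jets2D

variable {I : Set ℝ} {t₀ : ℝ}

/-- **The nested one-sided coefficients depend only on the values on the slab**: if `F = G` on `ℝ × I`
then all their nested one-sided coefficients at `(0, t₀)`, `t₀ ∈ I`, agree (`iteratedDerivWithin_congr`) —
whatever the two functions do off the slab. [cite: Dieudonne1974TreatiseIV, (19.5.1)] -/
theorem congr_slab {F G : ℝ → ℝ → ℝ} (h : ∀ u, ∀ s ∈ I, F u s = G u s) (ht₀ : t₀ ∈ I) (a b : ℕ) :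
    iteratedDeriv a (fun u => iteratedDerivWithin b (F u) I t₀) 0
      = iteratedDeriv a (fun u => iteratedDerivWithin b (G u) I t₀) 0 := by
  have hfun : (fun u => iteratedDerivWithin b (F u) I t₀) = fun u => iteratedDerivWithin b (G u) I t₀ := by
    funext u
    exact iteratedDerivWithin_congr (s := I) (f := F u) (g := G u) (fun s hs => h u s hs) ht₀
  rw [hfun]

/-- **Equal nested one-sided `n`-jets are preserved by a smooth outer function** — Dieudonné (19.5.5)
(*"if h = f ∘ g, we have h̃ = f̃(g̃₁, …, g̃_n)"*: the Taylor series of a composite depends only on those of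
the constituents), nested one-sided form: if `F, G : ℝ → ℝ → ℝ` are `C^∞` within the slab `univ ×ˢ I`
(`I` of unique differentiability, `t₀ ∈ I`), take values in an open set `U` on the slab, `φ` is `C^∞` on
`U`, and the nested one-sided `(a, b)`-coefficients of `F` and `G` at `(0, t₀)` agree for `a + b ≤ n`, then
so do those of `φ ∘ F` and `φ ∘ G`.  Proof: Faà di Bruno WITHIN `I` in the inner variable
(`iteratedDerivWithin_comp_eq_sum_orderedFinpartition`), as an identity of smooth functions of the outer
variable (`contDiff_iteratedDerivWithin_slice`), then the two-sided one-variable jet calculus of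
`NestedJets` in the outer variable. [cite: Dieudonne1974TreatiseIV, (19.5.5)] -/
theorem comp {n : ℕ} (hI : UniqueDiffOn ℝ I) (ht₀ : t₀ ∈ I) {U : Set ℝ} (hU : IsOpen U) {φ : ℝ → ℝ}
    (hφ : ContDiffOn ℝ ∞ φ U) {F G : ℝ → ℝ → ℝ}
    (hF : ContDiffOn ℝ ∞ (Function.uncurry F) (univ ×ˢ I))
    (hG : ContDiffOn ℝ ∞ (Function.uncurry G) (univ ×ˢ I))
    (hFU : ∀ u, ∀ s ∈ I, F u s ∈ U) (hGU : ∀ u, ∀ s ∈ I, G u s ∈ U)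
    (h : ∀ a b, a + b ≤ n → iteratedDeriv a (fun u => iteratedDerivWithin b (F u) I t₀) 0
      = iteratedDeriv a (fun u => iteratedDerivWithin b (G u) I t₀) 0) :
    ∀ a b, a + b ≤ n → iteratedDeriv a (fun u => iteratedDerivWithin b (fun s => φ (F u s)) I t₀) 0
      = iteratedDeriv a (fun u => iteratedDerivWithin b (fun s => φ (G u s)) I t₀) 0 := by
  intro a b hab
  -- Faà di Bruno within `I` in the inner variable, as functions of `u`
  have hfaa : ∀ {H : ℝ → ℝ → ℝ}, ContDiffOn ℝ ∞ (Function.uncurry H) (univ ×ˢ I) →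
      (∀ u, ∀ s ∈ I, H u s ∈ U) →
      (fun u => iteratedDerivWithin b (fun s => φ (H u s)) I t₀)
        = fun u => ∑ c : OrderedFinpartition b, iteratedDeriv c.length φ (H u t₀)
            * ∏ j, iteratedDerivWithin (c.partSize j) (H u) I t₀ := by
    intro H hH hHU
    funext u
    have hφu : ContDiffWithinAt ℝ (b : ℕ∞ω) φ univ (H u t₀) :=
      ((hφ.contDiffAt (hU.mem_nhds (hHU u t₀ ht₀))).of_le (natCast_le_infty b)).contDiffWithinAt
    have key := iteratedDerivWithin_comp_eq_sum_orderedFinpartition hφu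
      (contDiffWithinAt_slice hH ht₀ u b) uniqueDiffOn_univ hI ht₀ (mapsTo_univ _ _) le_rfl
    simp only [iteratedDerivWithin_univ] at key
    exact key
  rw [hfaa hF hFU, hfaa hG hGU]
  -- smoothness of the pieces as functions of `u`
  have hval : ∀ {H : ℝ → ℝ → ℝ}, ContDiffOn ℝ ∞ (Function.uncurry H) (univ ×ˢ I) →
      ContDiff ℝ ∞ (fun u => H u t₀) := fun hH => contDiff_slice_val hH ht₀
  have hder : ∀ {H : ℝ → ℝ → ℝ}, ContDiffOn ℝ ∞ (Function.uncurry H) (univ ×ˢ I) → ∀ p : ℕ,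
      ContDiff ℝ ∞ (fun u => iteratedDerivWithin p (H u) I t₀) := fun hH p =>
    contDiff_iteratedDerivWithin_slice hH hI ht₀ p
  have hout : ∀ {H : ℝ → ℝ → ℝ}, ContDiffOn ℝ ∞ (Function.uncurry H) (univ ×ˢ I) →
      (∀ u, ∀ s ∈ I, H u s ∈ U) → ∀ ℓ : ℕ, ContDiff ℝ ∞ (fun u => iteratedDeriv ℓ φ (H u t₀)) :=
    fun hH hHU ℓ => (contDiffOn_iteratedDeriv hU hφ ℓ).comp_contDiff (hval hH) fun u => hHU u t₀ ht₀
  refine NestedJet.jet_sum (a := a) Finset.univ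
    (fun c _ => (hout hF hFU _).mul (contDiff_prod fun j _ => hder hF _))
    (fun c _ => (hout hG hGU _).mul (contDiff_prod fun j _ => hder hG _)) ?_ a le_rfl
  intro c _
  refine NestedJet.jet_mul (hout hF hFU _) (hout hG hGU _) (contDiff_prod fun j _ => hder hF _)
    (contDiff_prod fun j _ => hder hG _) ?_ ?_
  · -- outer factor: composition of `F(·, t₀)`, `G(·, t₀)` with `iteratedDeriv ℓ φ`
    refine NestedJet.jet_comp hU (contDiffOn_iteratedDeriv hU hφ _) (hval hF) (hval hG)
      (fun u => hFU u t₀ ht₀) ?_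
    intro i hi
    have := h i 0 (by omega)
    simpa using this
  · refine NestedJet.jet_prod Finset.univ (fun j _ => hder hF _) (fun j _ => hder hG _) ?_
    intro j _ i hi
    exact h i (c.partSize j) (by have := c.partSize_le j; omega)

/-- **Equal nested one-sided `n`-jets are preserved by multiplication with a common factor smooth
within the slab** — (19.5.1): `o_n` is an ideal (Leibniz WITHIN `I` in the inner variable,
`iteratedDerivWithin_mul`, as an identity of smooth functions of the outer variable, then
`NestedJet.jet_sum`/`jet_mul`). [cite: Dieudonne1974TreatiseIV, (19.5.1)] -/
theorem mul {n : ℕ} (hI : UniqueDiffOn ℝ I) (ht₀ : t₀ ∈ I) {H F G : ℝ → ℝ → ℝ}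
    (hH : ContDiffOn ℝ ∞ (Function.uncurry H) (univ ×ˢ I))
    (hF : ContDiffOn ℝ ∞ (Function.uncurry F) (univ ×ˢ I))
    (hG : ContDiffOn ℝ ∞ (Function.uncurry G) (univ ×ˢ I))
    (h : ∀ a b, a + b ≤ n → iteratedDeriv a (fun u => iteratedDerivWithin b (F u) I t₀) 0
      = iteratedDeriv a (fun u => iteratedDerivWithin b (G u) I t₀) 0) :
    ∀ a b, a + b ≤ n →
      iteratedDeriv a (fun u => iteratedDerivWithin b (fun s => H u s * F u s) I t₀) 0
        = iteratedDeriv a (fun u => iteratedDerivWithin b (fun s => H u s * G u s) I t₀) 0 := by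
  intro a b hab
  have hleib : ∀ {K : ℝ → ℝ → ℝ}, ContDiffOn ℝ ∞ (Function.uncurry K) (univ ×ˢ I) →
      (fun u => iteratedDerivWithin b (fun s => H u s * K u s) I t₀)
        = fun u => ∑ k ∈ Finset.range (b + 1), (b.choose k : ℝ) * iteratedDerivWithin k (H u) I t₀
            * iteratedDerivWithin (b - k) (K u) I t₀ := by
    intro K hK
    funext u
    exact iteratedDerivWithin_mul ht₀ hI (contDiffWithinAt_slice hH ht₀ u b)
      (contDiffWithinAt_slice hK ht₀ u b)
  rw [hleib hF, hleib hG]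
  have hder : ∀ {K : ℝ → ℝ → ℝ}, ContDiffOn ℝ ∞ (Function.uncurry K) (univ ×ˢ I) → ∀ p : ℕ,
      ContDiff ℝ ∞ (fun u => iteratedDerivWithin p (K u) I t₀) := fun hK p =>
    contDiff_iteratedDerivWithin_slice hK hI ht₀ p
  refine NestedJet.jet_sum (a := a) (Finset.range (b + 1))
    (fun k _ => (contDiff_const.mul (hder hH _)).mul (hder hF _))
    (fun k _ => (contDiff_const.mul (hder hH _)).mul (hder hG _)) ?_ a le_rfl
  intro k hk
  refine NestedJet.jet_mul (contDiff_const.mul (hder hH _)) (contDiff_const.mul (hder hH _)) (hder hF _)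
    (hder hG _) (fun i _ => rfl) ?_
  intro i hi
  exact h i (b - k) (by omega)

end Jets2D

/-! ### Three variables: the one-sided derivative in the last variable is jointly smooth in the others -/

section Slice₂

variable {I : Set ℝ} {t₀ : ℝ}

/-- For `K : ℝ → ℝ → ℝ → ℝ` of class `C^∞` within the slab `(ℝ × ℝ) × I` (`I` of unique
differentiability, `t₀ ∈ I`), the one-sided derivative in the last variable,
`N_b(u, s) = ∂^b_{t,I}K(u, s, t₀) = iteratedDerivWithin b (K u s) I t₀`, is JOINTLY `C^∞` in `(u, s) ∈ ℝ²`
(`contDiff_iteratedDerivWithin_slice` with parameter space `ℝ × ℝ`) — so the two-sided nested-jet calculus of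
`NestedJets` (e.g. the diagonal Taylor lemma `NestedJet.iteratedDeriv_diag_eq_taylorSum`) applies to `N_b`.
[cite: Coleman2012, §4.5] -/
theorem contDiff_uncurry_iteratedDerivWithin_slice₂ {K : ℝ → ℝ → ℝ → ℝ} (hI : UniqueDiffOn ℝ I)
    (hK : ContDiffOn ℝ ∞ (fun p : (ℝ × ℝ) × ℝ => K p.1.1 p.1.2 p.2) (univ ×ˢ I)) (ht₀ : t₀ ∈ I) (b : ℕ) :
    ContDiff ℝ ∞ (Function.uncurry fun u s => iteratedDerivWithin b (K u s) I t₀) :=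
  contDiff_iteratedDerivWithin_slice (P := ℝ × ℝ) (H := fun p t => K p.1 p.2 t) hK hI ht₀ b

end Slice₂

end Literature.Analysis.Calculus.NestedJetWithin

end
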